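import Literature.MathematicalPhysics.QuantumFieldTheory.Balaban1983to89.B2Sect3C

/-!
# `Balaban1983to89.B2Eq350CorridorCover` — [Balaban1982Higgs2] Sect. 3.C p. 593 **(3.48)–(3.50)**: the CORRIDOR
# CONSTRUCTION `𝒟₀, 𝒟₁, …, 𝒟_{K−1}` as lattice geometry in ℤᵈ across the scales — the covers `Λ₀⁽ᵏ⁾ᶜ ⊂ ⋃_{□∈𝒟_k} □`
# PROVED from the two cover properties the construction supplies, and the resulting VOLUME COUNTS for `|Λ₀⁽ᵏ⁾ᶜ|`
# and for the collars (any set within a fixed sup-distance of `Λ₀⁽ᵏ⁾ᶜ`)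

statement-level skeleton of published theorems with citation tags; proofs where landed; nothing here is a claim about the Yang–Mills mass gap

PDF held: `paper:balaban1982-cmp86-higgs23-ii` (T. Bałaban, *(Higgs)₂,₃ quantum fields in a finite volume. II. An upper
bound*, Commun. Math. Phys. **86** (1982) 555–594 [Balaban1982Higgs2]; journal page = PDF page + 554); p. 593 [PDF 39]
READ AS AN IMAGE on `run/shared/lean/pub/pub-balaban/b2b-balaban-ref1/pages/1982-cmp86-higgs23-II/
1982-cmp86-higgs23-II-p039-x2.png`, with p. 566 [PDF 12] ("admissible": *"Λ₀⁽ʲ⁺¹⁾ ⊂ Λ₇⁽ʲ⁾′"*), (2.8) p. 558 [PDF 4] and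
part I p. 607 [PDF 5 of `1982-cmp85-higgs23-I`] ((1.16)–(1.20): the operation ′ and blocks, `T⁽ᵏ⁺¹⁾ = (T⁽ᵏ⁾)′`).

CITATION HEADER (lean-in-tree rule).  Cell `lit-balaban` (HOME `run/shared/lean/pub/lit-balaban/`), Phase-2 proof seat
**p23** gen 8 (unit `lit-balaban-p23-g8`); SKELETON row **B2.Eq3.47** ((3.43)–(3.54) pp. 592–594), members
(3.48)–(3.50) = the geometric leaf `B2Sect3C.Bound350` (typed, unproved; its counting half is `B2Sect3C.card_le_of_cover`,
`card_latticeCube`) — the last input of the §3.C chain that is not of printed shape after this seat's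
`B2Ineq347SeqCount`/`B2Ineq347SumToSup`/`B2Ineq342From346` (p268178/p268649/p269421); fold owner r02, second reader
r14, referee ref-4.  Uses `B2Sect3C.card_latticeCube` BY NAME; nothing of another seat is restated (the single-scale
CONCRETE regions of typer g8 `B2Eq28RegionsConcrete` are a model this file's hypotheses are meant to be fed by; they
are not imported here).

WHAT IS PRINTED (p. 593 [PDF 39], verbatim).  *"Now we will express |Λ₀⁽ᵏ⁾ᶜ| by the help of |𝒞_k|. We will construct a
sequence 𝒟₀, 𝒟₁, …, 𝒟_{K−1} of families of cubes with the properties that Λ₀⁽ᵏ⁾ᶜ is contained in the sum of cubes of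
the family 𝒟_k. We take 𝒟₀ = 𝒞₀. Of course  Λ₀⁽⁰⁾ᶜ ⊂ ⋃_{□∈𝒟₀} □  and  |Λ₀⁽⁰⁾ᶜ| ≤ (2r(ε))ᵈ|𝒞₀|.  (3.48)  To each cube
from 𝒟₀ we add a "corridor" consisting of large blocks and of thickness > 9r(ε), but < 10r(ε). We get a cube with a
side of length < 22r(ε) and we apply the operation ′ to it, i.e. we take the set of small blocks. After rescaling we get
a cube of the lattice T₁⁽¹⁾ with a side of length < L⁻¹22r(ε). We add 𝒞₁ to the obtained set of cubes and we denote the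
sum by 𝒟₁. From the definition of Λ₀⁽¹⁾ we have  Λ₀⁽¹⁾ᶜ ⊂ ⋃_{□∈𝒟₁} □  and  |Λ₀⁽¹⁾ᶜ| ≤ (L⁻¹22r(ε))ᵈ|𝒞₀| +
(2r(Lε))ᵈ|𝒞₁|.  (3.49)  We continue this procedure and we get a sequence of families of cubes 𝒟₀, 𝒟₁, 𝒟₂, …, 𝒟_{K−1}
with the following properties  Λ₀⁽ᵏ⁾ᶜ ⊂ ⋃_{□∈𝒟_k} □  and  |Λ₀⁽ᵏ⁾ᶜ| ≤ (L⁻ᵏ22r(ε) + L^{−(k−1)}20r(Lε) + … +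
L⁻¹20r(Lᵏ⁻¹ε))ᵈ|𝒞₀| + … + (L⁻¹22r(Lᵏ⁻¹ε))ᵈ|𝒞_{k−1}| + (2r(Lᵏε))ᵈ|𝒞_k|.  (3.50)"*  What *"From the definition of
Λ₀⁽¹⁾"* uses (p. 566: *"In general Λ₀⁽ʲ⁺¹⁾ ⊂ Λ₇⁽ʲ⁾′"*; p. 592: 𝒞_k = the cubes meeting `Λ₇⁽ᵏ⁻¹⁾′ ∩ Λ₀⁽ᵏ⁾ᶜ`; (2.8):
`Λ_{i+1}ᶜ` = the large blocks within r(ε) of `Λ_iᶜ`, so `Λ₇⁽ᵏ⁾ᶜ` lies within `7(r(Lᵏε) + ML)` of `Λ₀⁽ᵏ⁾ᶜ`): the NEW part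
`Λ₀⁽ᵏ⁺¹⁾ᶜ ∩ Λ₇⁽ᵏ⁾′` is covered by `𝒞_{k+1}`, the OLD part `(Λ₇⁽ᵏ⁾′)ᶜ = (Λ₇⁽ᵏ⁾ᶜ)′` is the blocked image of a set within the
corridor thickness of `Λ₀⁽ᵏ⁾ᶜ`.

THE MODEL (model-independent lattice geometry; DICTIONARY print ↦ Lean).  Level-k unit lattice `T₁⁽ᵏ⁾` ↦ `ℤᵈ = Fin d → ℤ`
(torus identifications only lower the counts — the convention of `B2Sect3C`); the operation ′ / rescaling `T₁⁽ᵏ⁾ →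
T₁⁽ᵏ⁺¹⁾` ↦ the blocking map `blk L x = (⌊x_i/L⌋)_i`; a cube ↦ `box a n = Π_i [a_i, a_i + n) ∩ ℤᵈ` (corner, integer side;
`B2Sect3C.card_latticeCube`: `nᵈ` points), a family of cubes ↦ a `Finset` of pairs (corner, side), its union ↦ `cubes`;
"add a corridor of thickness t and rescale" ↦ `stepCube L t` (fatten the box by `t` on every side, block it: a box of
side `(n + 2t)/L + 2` — the `+2` is the lattice rounding the print ignores); `Λ₀⁽ᵏ⁾ᶜ` ↦ `W k`, `𝒞_k` ↦ `C k`, the corridor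
half-thickness used between levels k and k+1 ↦ `t k`, and the evolved cube of `𝒞_l` at level `l + j` ↦ `evolve L t l j`.
The two COVER HYPOTHESES: `W 0 ⊆ cubes (C 0)` ((3.43)) and, for every k, every point of `W (k+1)` lies in `cubes (C (k+1))`
(new part, (3.45)) or is the blocked image of a point within sup-distance `t k` of `W k` (old part, p. 566 + (2.8)).

WHAT IS KERNEL-CHECKED (zero `sorry`; axioms standard).
 §1 lattice boxes: `mem_box`, `card_box`, `mem_box_of_near` (fattening), `blk_mem_box` (blocking a box of side `m ≤ Lq`
    lands in a box of side `q + 1`), `mem_cubes`, `stepCube_covers` (corridor + rescaling of one cube).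
 §2 the construction: `evolve`, `evolve_succ`, **`cover`** (`Λ₀⁽ᵏ⁾ᶜ ⊂ ⋃_{□∈𝒟_k} □` with `𝒟_k = ⋃_{l≤k}` evolved `𝒞_l`, by
    induction on k — (3.48), (3.49), (3.50) left halves), `sideB`/`evolve_side_le` (sides along the evolution),
    **`card_le_cover`** (`|Λ₀⁽ᵏ⁾ᶜ| ≤ Σ_{l≤k} |𝒞_l|·(side of the evolved cubes)ᵈ` — (3.50) right half with honest lattice
    sides), **`card_collar_le_cover`** (the same for ANY set within sup-distance `t′` of `Λ₀⁽ᵏ⁾ᶜ`, sides `+ 2t′` — the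
    collar analogue the chain needs for `|Λ₇⁽ᵏ⁾ᶜ|`, `|Λ₅⁽ᵏ⁾ᶜ|`, cell GAPS G-pv04-3 (ii)).
 The ARITHMETIC turning these sides into `O(1)·r(Lᵏε)` ((3.51)–(3.52)) and the bridge to `B2Sect3C.Bound352` / the collar
 hypotheses of `B2Ineq342From346.ineq342_of_346` are the sibling `B2Ineq352CorridorBound`.

HONEST SCOPE.  (a) ℤᵈ in place of the tori; sup-distance fattening (contains the Euclidean one).  (b) The literal
coefficients of (3.50) (`B2Sect3C.coef350`: `L⁻¹22r`, `L⁻¹20r`, no rounding) are NOT reproduced: blocking a lattice box of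
side `m` gives side `⌈m/L⌉ + 1`, not `m/L`; this file keeps exact integer sides (`sideB`) and the sibling bounds them by
`O(1)r(Lᵏε)`, which is the (3.52) shape the chain consumes — the printed (3.50) is an intermediate display whose
rounding the print ignores (recorded, not an erratum: (3.52) and (3.42) are unaffected).  (c) The cover hypotheses are
the DEFINING properties of the construction ((3.43)/(3.45) define `𝒞_k` as the cubes meeting the new part; p. 566 +
(2.8) give the old part); feeding them from a concrete multi-scale region model is not done here.  (d) Value = the
geometric leaf of §3.C as kernel-checked lattice geometry with every input named; NOT summit progress.
-/

namespace Literature.MathematicalPhysics.QuantumFieldTheory.Balaban1983to89.B2Eq350CorridorCover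

open Finset
open Literature.MathematicalPhysics.QuantumFieldTheory.Balaban1983to89

variable {d : ℕ}

/-! ## §1. Lattice boxes in ℤᵈ, fattening, blocking -/

/-- A cube of the unit lattice: corner `a ∈ ℤᵈ`, integer side `n`, points `Π_i [a_i, a_i + n)` (*"each cube is a sum
of large blocks"*, p. 592 — integer sides). [cite: Balaban1982Higgs2, (3.43) p.592] -/
noncomputable def box (a : Fin d → ℤ) (n : ℕ) : Finset (Fin d → ℤ) := Fintype.piFinset fun i => Finset.Ico (a i) (a i + n)

/-- Membership in a box, coordinatewise. [cite: Balaban1982Higgs2, (3.43) p.592] -/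
theorem mem_box {a : Fin d → ℤ} {n : ℕ} {x : Fin d → ℤ} : x ∈ box a n ↔ ∀ i, a i ≤ x i ∧ x i < a i + n := by
  simp [box, Fintype.mem_piFinset, Finset.mem_Ico]

/-- A box of side `n` has `nᵈ` lattice points (`B2Sect3C.card_latticeCube`). [cite: Balaban1982Higgs2, (3.48) p.593] -/
theorem card_box (a : Fin d → ℤ) (n : ℕ) : (box a n).card = n ^ d := B2Sect3C.card_latticeCube a n

/-- FATTENING ("we add a corridor … of thickness t"): a point within sup-distance `t` of a box of side `n` lies in the
concentric box of side `n + 2t`. [cite: Balaban1982Higgs2, (3.49) p.593] -/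
theorem mem_box_of_near {a x y : Fin d → ℤ} {n t : ℕ} (hx : x ∈ box a n)
    (hy : ∀ i, y i - x i ≤ t ∧ x i - y i ≤ t) : y ∈ box (fun i => a i - t) (n + 2 * t) := by
  rw [mem_box] at hx ⊢
  intro i
  obtain ⟨h1, h2⟩ := hx i
  obtain ⟨h3, h4⟩ := hy i
  constructor
  · linarith
  · push_cast; linarith

/-- The operation ′ / rescaling `T₁⁽ᵏ⁾ → T₁⁽ᵏ⁺¹⁾ = (T₁⁽ᵏ⁾)′` on sites: `x ↦ (⌊x_i/L⌋)_i` (the point of the block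
containing `x`; part I (1.16)–(1.20)). [cite: Balaban1982Higgs2, (3.49) p.593] -/
def blk (L : ℕ) (x : Fin d → ℤ) : Fin d → ℤ := fun i => x i / (L : ℤ)

/-- RESCALING A BOX ("After rescaling we get a cube of the lattice T₁⁽¹⁾"): the blocked image of a box of side `m ≤ Lq`
lies in the box with blocked corner and side `q + 1` (the honest lattice count; the print's `L⁻¹·side` ignores the
rounding). [cite: Balaban1982Higgs2, (3.49) p.593] -/
theorem blk_mem_box {L : ℕ} (hL : 0 < L) {a x : Fin d → ℤ} {m q : ℕ} (hx : x ∈ box a m)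
    (hq : (m : ℤ) ≤ (L : ℤ) * q) : blk L x ∈ box (blk L a) (q + 1) := by
  rw [mem_box] at hx ⊢
  have hL' : (0 : ℤ) < (L : ℤ) := by exact_mod_cast hL
  intro i
  obtain ⟨h1, h2⟩ := hx i
  refine ⟨Int.ediv_le_ediv hL' h1, ?_⟩
  have hx' : x i ≤ a i - 1 + (L : ℤ) * q := by linarith
  have h3 : x i / (L : ℤ) ≤ (a i - 1 + (L : ℤ) * q) / (L : ℤ) := Int.ediv_le_ediv hL' hx'
  have h4 : (a i - 1 + (L : ℤ) * q) / (L : ℤ) = (a i - 1) / (L : ℤ) + q := Int.add_mul_ediv_left _ _ hL'.ne'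
  have h5 : (a i - 1) / (L : ℤ) ≤ a i / (L : ℤ) := Int.ediv_le_ediv hL' (by linarith)
  show x i / (L : ℤ) < a i / (L : ℤ) + ((q + 1 : ℕ) : ℤ)
  push_cast
  linarith

/-- The union of the boxes of a family of cubes (corner, side): `⋃_{□∈𝒟} □`. [cite: Balaban1982Higgs2, (3.48) p.593] -/
noncomputable def cubes (C : Finset ((Fin d → ℤ) × ℕ)) : Finset (Fin d → ℤ) := C.biUnion fun c => box c.1 c.2

/-- Membership in `⋃_{□∈𝒟} □`. [cite: Balaban1982Higgs2, (3.48) p.593] -/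
theorem mem_cubes {C : Finset ((Fin d → ℤ) × ℕ)} {x : Fin d → ℤ} :
    x ∈ cubes C ↔ ∃ c ∈ C, x ∈ box c.1 c.2 := by
  simp [cubes]

/-- ONE STEP OF THE CONSTRUCTION on one cube: add a corridor of thickness `t` on every side and rescale by `L` — the
new cube has corner `blk L (a − t)` and side `(n + 2t)/L + 2`. [cite: Balaban1982Higgs2, (3.49) p.593] -/
def stepCube (L t : ℕ) (c : (Fin d → ℤ) × ℕ) : (Fin d → ℤ) × ℕ :=
  (blk L (fun i => c.1 i - t), (c.2 + 2 * t) / L + 2)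

/-- What one step covers: the blocked image of every point within sup-distance `t` of the cube `c` lies in
`stepCube L t c`. [cite: Balaban1982Higgs2, (3.49) p.593] -/
theorem stepCube_covers {L : ℕ} (hL : 0 < L) {t : ℕ} {c : (Fin d → ℤ) × ℕ} {x y : Fin d → ℤ}
    (hx : x ∈ box c.1 c.2) (hy : ∀ i, y i - x i ≤ t ∧ x i - y i ≤ t) :
    blk L y ∈ box (stepCube L t c).1 (stepCube L t c).2 := by
  have hy' := mem_box_of_near hx hy
  have hq : ((c.2 + 2 * t : ℕ) : ℤ) ≤ (L : ℤ) * (((c.2 + 2 * t) / L + 1 : ℕ) : ℤ) := by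
    exact_mod_cast (Nat.lt_mul_div_succ (c.2 + 2 * t) hL).le
  exact blk_mem_box hL hy' hq

/-! ## §2. The construction `𝒟₀, …, 𝒟_{K−1}` and the covers (3.48)–(3.50) -/

/-- The cube of `𝒞_l` evolved through `j` steps of the construction (corridor of half-thickness `t (l + i)` and
rescaling between levels `l + i` and `l + i + 1`): a cube of `𝒟_{l+j}`. [cite: Balaban1982Higgs2, (3.50) p.593] -/
def evolve (L : ℕ) (t : ℕ → ℕ) (l : ℕ) : ℕ → ((Fin d → ℤ) × ℕ) → ((Fin d → ℤ) × ℕ)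
  | 0, c => c
  | j + 1, c => stepCube L (t (l + j)) (evolve L t l j c)

/-- Unfolding of one more step. [cite: Balaban1982Higgs2, (3.50) p.593] -/
theorem evolve_succ (L : ℕ) (t : ℕ → ℕ) (l j : ℕ) (c : (Fin d → ℤ) × ℕ) :
    evolve L t l (j + 1) c = stepCube L (t (l + j)) (evolve L t l j c) := rfl

/-- **THE COVERS (3.48)–(3.50)**, PROVED: `Λ₀⁽ᵏ⁾ᶜ ⊂ ⋃_{□∈𝒟_k} □` with `𝒟_k` = the cubes of `𝒞_l`, `l ≤ k`, evolved to
level `k` — by induction on `k` from the two cover properties of the construction: `Λ₀⁽⁰⁾ᶜ ⊂ ∪𝒞₀` ((3.43)), and every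
point of `Λ₀⁽ᵏ⁺¹⁾ᶜ` either lies in `∪𝒞_{k+1}` (the new part `Λ₇⁽ᵏ⁾′ ∩ Λ₀⁽ᵏ⁺¹⁾ᶜ`, (3.45)) or is the rescaled image of a
point within sup-distance `t k` of `Λ₀⁽ᵏ⁾ᶜ` (the old part `(Λ₇⁽ᵏ⁾ᶜ)′`, p. 566 *"Λ₀⁽ʲ⁺¹⁾ ⊂ Λ₇⁽ʲ⁾′"* with (2.8)).
[cite: Balaban1982Higgs2, (3.48)–(3.50) p.593] -/
theorem cover {L : ℕ} (hL : 0 < L) (t : ℕ → ℕ) (W : ℕ → Finset (Fin d → ℤ))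
    (C : ℕ → Finset ((Fin d → ℤ) × ℕ)) (h0 : W 0 ⊆ cubes (C 0))
    (hnew : ∀ k, ∀ y ∈ W (k + 1), y ∈ cubes (C (k + 1)) ∨
      ∃ x ∈ W k, ∃ z : Fin d → ℤ, (∀ i, z i - x i ≤ t k ∧ x i - z i ≤ t k) ∧ blk L z = y)
    (k : ℕ) :
    W k ⊆ (range (k + 1)).biUnion fun l => (C l).biUnion fun c =>
      box (evolve L t l (k - l) c).1 (evolve L t l (k - l) c).2 := by
  induction k with
  | zero =>
    intro y hy
    have hy' := h0 hy
    rw [mem_cubes] at hy'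
    obtain ⟨c, hc, hyc⟩ := hy'
    simp only [Finset.mem_biUnion, Finset.mem_range]
    exact ⟨0, Nat.zero_lt_one, c, hc, by simpa [evolve] using hyc⟩
  | succ k ih =>
    intro y hy
    simp only [Finset.mem_biUnion, Finset.mem_range]
    rcases hnew k y hy with hC | ⟨x, hx, z, hz, rfl⟩
    · rw [mem_cubes] at hC
      obtain ⟨c, hc, hyc⟩ := hC
      exact ⟨k + 1, Nat.lt_succ_self _, c, hc, by simpa [evolve] using hyc⟩
    · have hx' := ih hx
      simp only [Finset.mem_biUnion, Finset.mem_range] at hx'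
      obtain ⟨l, hl, c, hc, hxc⟩ := hx'
      refine ⟨l, by omega, c, hc, ?_⟩
      have e : k + 1 - l = (k - l) + 1 := by omega
      rw [e, evolve_succ, show l + (k - l) = k by omega]
      exact stepCube_covers hL hxc hz

/-- The side of a cube of `𝒞_l` (side `≤ s l`) after `j` steps: `sideB 0 = s l`, `sideB (j+1) = (sideB j + 2t(l+j))/L + 2`
(exact lattice sides; the print's `L⁻¹(side + 20r)` without rounding). [cite: Balaban1982Higgs2, (3.50) p.593] -/
def sideB (L : ℕ) (t s : ℕ → ℕ) (l : ℕ) : ℕ → ℕ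
  | 0 => s l
  | j + 1 => (sideB L t s l j + 2 * t (l + j)) / L + 2

/-- Sides along the evolution are bounded by `sideB`. [cite: Balaban1982Higgs2, (3.50) p.593] -/
theorem evolve_side_le (L : ℕ) (t s : ℕ → ℕ) (l : ℕ) {c : (Fin d → ℤ) × ℕ} (hc : c.2 ≤ s l) :
    ∀ j, (evolve L t l j c).2 ≤ sideB L t s l j
  | 0 => by simpa [evolve, sideB] using hc
  | j + 1 => by
    rw [evolve_succ]
    show ((evolve L t l j c).2 + 2 * t (l + j)) / L + 2 ≤ (sideB L t s l j + 2 * t (l + j)) / L + 2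
    have := evolve_side_le L t s l hc j
    gcongr

/-- **(3.50), right half, with exact lattice sides**: `|Λ₀⁽ᵏ⁾ᶜ| ≤ Σ_{l≤k} |𝒞_l| · sideB(l, k − l)ᵈ` — the union bound
over `𝒟_k` (`B2Sect3C.card_le_of_cover` pattern: each evolved cube of `𝒞_l` has `≤ sideBᵈ` points).
[cite: Balaban1982Higgs2, (3.50) p.593] -/
theorem card_le_cover {L : ℕ} (hL : 0 < L) (t s : ℕ → ℕ) (W : ℕ → Finset (Fin d → ℤ))
    (C : ℕ → Finset ((Fin d → ℤ) × ℕ)) (h0 : W 0 ⊆ cubes (C 0))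
    (hnew : ∀ k, ∀ y ∈ W (k + 1), y ∈ cubes (C (k + 1)) ∨
      ∃ x ∈ W k, ∃ z : Fin d → ℤ, (∀ i, z i - x i ≤ t k ∧ x i - z i ≤ t k) ∧ blk L z = y)
    (hs : ∀ k, ∀ c ∈ C k, c.2 ≤ s k) (k : ℕ) :
    (W k).card ≤ ∑ l ∈ range (k + 1), (C l).card * sideB L t s l (k - l) ^ d := by
  calc (W k).card ≤ ((range (k + 1)).biUnion fun l => (C l).biUnion fun c =>
        box (evolve L t l (k - l) c).1 (evolve L t l (k - l) c).2).card :=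
        Finset.card_le_card (cover hL t W C h0 hnew k)
    _ ≤ ∑ l ∈ range (k + 1), ((C l).biUnion fun c =>
        box (evolve L t l (k - l) c).1 (evolve L t l (k - l) c).2).card := Finset.card_biUnion_le
    _ ≤ ∑ l ∈ range (k + 1), (C l).card * sideB L t s l (k - l) ^ d := by
        refine Finset.sum_le_sum fun l _ => ?_
        calc ((C l).biUnion fun c => box (evolve L t l (k - l) c).1 (evolve L t l (k - l) c).2).card
            ≤ ∑ c ∈ C l, (box (evolve L t l (k - l) c).1 (evolve L t l (k - l) c).2).card :=
              Finset.card_biUnion_le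
          _ ≤ ∑ _c ∈ C l, sideB L t s l (k - l) ^ d := by
              refine Finset.sum_le_sum fun c hc => ?_
              rw [card_box]
              exact Nat.pow_le_pow_left (evolve_side_le L t s l (hs l c hc) (k - l)) d
          _ = (C l).card * sideB L t s l (k - l) ^ d := by rw [Finset.sum_const, smul_eq_mul]

/-- **The collar analogue** (what the chain needs for `|Λ₇⁽ᵏ⁾ᶜ|`, `|Λ₅⁽ᵏ⁾ᶜ|`; cell GAPS G-pv04-3 (ii)): any finite set
`V` every point of which lies within sup-distance `t′` of `Λ₀⁽ᵏ⁾ᶜ` (for `Λ₇⁽ᵏ⁾ᶜ`: `t′ = 7(r(Lᵏε) + ML)` by (2.8)) is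
covered by the cubes of `𝒟_k` fattened by `t′`, hence `|V| ≤ Σ_{l≤k} |𝒞_l| · (sideB(l, k − l) + 2t′)ᵈ`.
[cite: Balaban1982Higgs2, (3.50) p.593] -/
theorem card_collar_le_cover {L : ℕ} (hL : 0 < L) (t s : ℕ → ℕ) (W : ℕ → Finset (Fin d → ℤ))
    (C : ℕ → Finset ((Fin d → ℤ) × ℕ)) (h0 : W 0 ⊆ cubes (C 0))
    (hnew : ∀ k, ∀ y ∈ W (k + 1), y ∈ cubes (C (k + 1)) ∨
      ∃ x ∈ W k, ∃ z : Fin d → ℤ, (∀ i, z i - x i ≤ t k ∧ x i - z i ≤ t k) ∧ blk L z = y)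
    (hs : ∀ k, ∀ c ∈ C k, c.2 ≤ s k) (k t' : ℕ) (V : Finset (Fin d → ℤ))
    (hV : ∀ y ∈ V, ∃ x ∈ W k, ∀ i, y i - x i ≤ t' ∧ x i - y i ≤ t') :
    V.card ≤ ∑ l ∈ range (k + 1), (C l).card * (sideB L t s l (k - l) + 2 * t') ^ d := by
  classical
  have hcov : V ⊆ (range (k + 1)).biUnion fun l => (C l).biUnion fun c =>
      box (fun i => (evolve L t l (k - l) c).1 i - t') ((evolve L t l (k - l) c).2 + 2 * t') := by
    intro y hy
    obtain ⟨x, hx, hxy⟩ := hV y hy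
    have hx' := cover hL t W C h0 hnew k hx
    simp only [Finset.mem_biUnion, Finset.mem_range] at hx' ⊢
    obtain ⟨l, hl, c, hc, hxc⟩ := hx'
    exact ⟨l, hl, c, hc, mem_box_of_near hxc hxy⟩
  calc V.card ≤ ((range (k + 1)).biUnion fun l => (C l).biUnion fun c =>
        box (fun i => (evolve L t l (k - l) c).1 i - t') ((evolve L t l (k - l) c).2 + 2 * t')).card :=
        Finset.card_le_card hcov
    _ ≤ ∑ l ∈ range (k + 1), ((C l).biUnion fun c =>
        box (fun i => (evolve L t l (k - l) c).1 i - t') ((evolve L t l (k - l) c).2 + 2 * t')).card :=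
        Finset.card_biUnion_le
    _ ≤ ∑ l ∈ range (k + 1), (C l).card * (sideB L t s l (k - l) + 2 * t') ^ d := by
        refine Finset.sum_le_sum fun l _ => ?_
        calc ((C l).biUnion fun c =>
              box (fun i => (evolve L t l (k - l) c).1 i - t') ((evolve L t l (k - l) c).2 + 2 * t')).card
            ≤ ∑ c ∈ C l, (box (fun i => (evolve L t l (k - l) c).1 i - t')
                ((evolve L t l (k - l) c).2 + 2 * t')).card := Finset.card_biUnion_le
          _ ≤ ∑ _c ∈ C l, (sideB L t s l (k - l) + 2 * t') ^ d := by
              refine Finset.sum_le_sum fun c hc => ?_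
              rw [card_box]
              exact Nat.pow_le_pow_left (by have := evolve_side_le L t s l (hs l c hc) (k - l); omega) d
          _ = (C l).card * (sideB L t s l (k - l) + 2 * t') ^ d := by rw [Finset.sum_const, smul_eq_mul]

end Literature.MathematicalPhysics.QuantumFieldTheory.Balaban1983to89.B2Eq350CorridorCover
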